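import Summits.BirchSwinnertonDyer.BirchSwinnertonDyer.Theorems.AdditiveKolyvaginRoadKolyvaginPrimitiveOfIndexLowerBound
import HarnessLib

/-!
# Route `AdditiveKolyvaginRoad`: the TAME GROSS–ZAGIER SQUEEZE — first lemma of crux card `tame-gross-zagier-kk-prime`
# (crux KS′ `LevelKolyvaginSystemsAdditive`, item stmt-BirchSwinnertonDyer-21396; engine for the OPEN stub S5 of line `bdp_rebase`
# and, through the Heegner-index socket, for KPA′ `KolyvaginPrimitiveAdditive`, item 21400)
# (cell `pub/bsd-wall`, width seat `bsd-wall-akr-p2x-w4` g4; `--supports stmt-BirchSwinnertonDyer-21396`, helper)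

THEOREMS ONLY (no definition, no named fact, no `sorry`).  Nothing about the card's conjectural identity `TGZ_ℓ`, about any
`p`-part of BSD, or about Kolyvagin's conjecture is asserted — every such input is a HYPOTHESIS.  BSD is not proved by any of
this; KS′ and KPA′ stay OPEN at `p² ∣ N`.

THE POINT.  The crux-ideation card `Cruxes/LevelKolyvaginSystemsAdditive/Ideas/tame-gross-zagier-kk-prime.md` (round 1, seat 1,
2026-08-28) proposes an engine for the research residual of both Kolyvagin cruxes whose OUTPUT at one ♯ frame is an identity in
`ℤ/p^k` — the tame Gross–Zagier identity `TGZ_ℓ` at ONE inert Kato–Kolyvagin prime `ℓ` of level `p^k`: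
`h(y_K, y_K) = u · δ_ℓ(f) · δ_1(f^{d_K})` for a `ℤ/p^k`-valued (Bockstein ∕ Mazur–Tate type) height `h` on `E(K)`, a unit `u`, the
Mazur–Tate derivative `δ_ℓ(f)` (`kuriharaNumber f (p^k) ℓ ψ`) and `δ_1(f^{d_K}) = [0]⁺_{f^{d_K}}`.  Its typed sketch
(`Cruxes/…/TameGrossZagierSketch.lean`) isolates the FIRST LEMMA of any line built on it — «pure `ℤ/p^k` bookkeeping:
`I² · unit = unit · δ_ℓ · δ_1` with `p^s ∥ δ_ℓ`, `p^t ∥ δ_1`, `s + t < k` ⟹ `2 ord_p I = s + t ≤ ord_p #Ш(E/K)`, whence S5's conclusion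
`X11b.IndexLowerBoundAt W p K y`» — as `TameGrossZagier.FirstLemma : Prop`, «S-sized, provable now».  This file PROVES it, in a
form importable by a skeleton (the sketch's posited INTERFACE `TameHeight`, its `ExactPPow` and the consequence of
`TameGrossZagierAt` are unfolded into hypotheses; the two Kurihara numbers are generalised to arbitrary elements `δ₁ δ₂ : ℤ/p^k`, which
is all the squeeze uses):

* §0 exact powers of `p` in `ℤ/p^k` read on representatives (`natCast_pow_dvd_natCast_iff`, `padicValNat_val_eq_of_exact`,
  `not_dvd_val_of_isUnit`) and the valuation rigidity `padicValNat_eq_of_modEq_pow` («two non-zero integers congruent mod `p^k`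
  with valuations `< k` have the same valuation»).
* §1 `two_mul_padicValInt_eq_of_tameSqueeze` — the squeeze on ANY additive group `A` (`E(K)`): `h : A → ℤ/p^k` quadratic in
  scalars and invariant under torsion translation, `y = I • P₀ + T` (`T` torsion, `I ≠ 0`), `h P₀` a unit, `h y = u·δ₁·δ₂`,
  `p^s ∥ δ₁`, `p^t ∥ δ₂`, `s + t < k`, `2·ord_p I < k` ⟹ `2·ord_p I = s + t`.
* §2 `indexLowerBoundAt_of_tameSqueeze` — on `E(K)`: with `ord_p [E(K) : ℤy] = ord_p I` and `s + t ≤ ord_p #Ш(E/K)` the squeeze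
  gives `X11b.IndexLowerBoundAt W p K y` (the conclusion of S5 `BdpRebase.stub_indexLowerBoundAdditive`, by name) — literally the
  sketch's `FirstLemma` with its interface unfolded.
* §3 `exists_kolyvaginClass_ne_zero_of_tameSqueeze` — crux currency: at one ♯ frame (the binders of KPA′ ∕ of the registered stub
  `stub_kolyvaginPrimitiveAboveBottom` of line `epsilon_matched_retyping` that are used), a tame squeeze at EVERY Heegner point of
  the frame gives «some mod-`p` Kolyvagin class of Kolyvagin-prime support is non-zero» — the conclusion of KPA′ and of that stub —
  through width seat akr-p2x-w2's `AdditiveKoly.exists_kolyvaginClass_ne_zero_of_indexLowerBoundAt` (McCallum 1991 §5 read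
  backwards; published inputs Gross–Zagier ∕ Kolyvagin ∕ Kolyvagin's bound ∕ modularity ∕ McCallum Cor. 5.6 displayed as binders).

So the card's engine lands on the crux BY NAME the moment `TGZ_ℓ` (+ the Kato leg's exact orders, + the odd-`p` decomposition
`Ш(E/K)[p^∞] = Ш(E)[p^∞] ⊕ Ш(E^{d_K})[p^∞]` bounding `s + t`) is supplied at one inert Kato–Kolyvagin prime per Heegner point; nothing
here is progress on `TGZ_ℓ` itself (CONJECTURAL, the card's lever; its height is definition request D1 of the card).

References: B. Mazur, J. Tate, Duke Math. J. 54 (1987) §1; M. Kurihara, Münster J. Math. 7 (2014) §1; W. McCallum, in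
*L-functions and Arithmetic*, LMS LN 153 (1991) §5; D. Jetchev, C. Skinner, X. Wan, Camb. J. Math. 5 (2017) §7.4.1.
-/

-- D-0017: single-problem summit, so `Summit.BirchSwinnertonDyer.BirchSwinnertonDyer.…` repeats a namespace BY DESIGN.
set_option linter.dupNamespace false
set_option autoImplicit false

noncomputable section

open scoped Classical

open WeierstrassCurve NumberField Field
  Literature.NumberTheory.EllipticCurves Literature.NumberTheory.EllipticCurves.ModularForms
  Literature.NumberTheory.EllipticCurves.Rank1Residual Literature.NumberTheory.EllipticCurves.KolyvaginCocycle
  Summit.BirchSwinnertonDyer.Rank1Residual Summit.BirchSwinnertonDyer.Rank1Residual.X11b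
  Summit.BirchSwinnertonDyer.Rank1Residual.X11b.Three
  Summit.BirchSwinnertonDyer.BirchSwinnertonDyer.Theses.AdditiveKolyvaginRoad

namespace Summit.BirchSwinnertonDyer.BirchSwinnertonDyer.Theorems.AdditiveKoly.TameGrossZagier

/-! ## §0 Exact powers of `p` in `ℤ/p^k`, read on representatives -/

section ZModPow

variable {p : ℕ} [hp : Fact p.Prime] {k : ℕ}

/-- For `j ≤ k`, `p^j ∣ a` in `ℤ/p^k` iff `p^j ∣ a` in `ℕ` (reduce the witness mod `p^k` and use `p^j ∣ p^k`). [folklore] -/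
theorem natCast_pow_dvd_natCast_iff {j : ℕ} (hj : j ≤ k) (a : ℕ) :
    (p ^ j : ZMod (p ^ k)) ∣ (a : ZMod (p ^ k)) ↔ p ^ j ∣ a := by
  haveI : NeZero (p ^ k) := ⟨pow_ne_zero _ hp.out.ne_zero⟩
  constructor
  · rintro ⟨w, hw⟩
    have hmod : a ≡ p ^ j * w.val [MOD p ^ k] := by
      rw [← ZMod.natCast_eq_natCast_iff, hw, Nat.cast_mul, Nat.cast_pow, ZMod.natCast_zmod_val]
    exact (hmod.dvd_iff (pow_dvd_pow p hj)).mpr (dvd_mul_right _ _)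
  · rintro ⟨c, rfl⟩
    exact ⟨(c : ZMod (p ^ k)), by push_cast; ring⟩

/-- If `p^j` divides `x ∈ ℤ/p^k` exactly (`p^j ∣ x`, `p^{j+1} ∤ x`) with `j < k`, then the representative `x.val ∈ ℕ` is non-zero
of `p`-adic valuation exactly `j`. [folklore] -/
theorem padicValNat_val_eq_of_exact {j : ℕ} (hj : j < k) {x : ZMod (p ^ k)}
    (hx : (p ^ j : ZMod (p ^ k)) ∣ x ∧ ¬ (p ^ (j + 1) : ZMod (p ^ k)) ∣ x) :
    x.val ≠ 0 ∧ padicValNat p x.val = j := by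
  haveI : NeZero (p ^ k) := ⟨pow_ne_zero _ hp.out.ne_zero⟩
  obtain ⟨h1, h2⟩ := hx
  rw [← ZMod.natCast_zmod_val x] at h1 h2
  rw [natCast_pow_dvd_natCast_iff hj.le] at h1
  rw [natCast_pow_dvd_natCast_iff (Nat.succ_le_of_lt hj)] at h2
  have hx0 : x.val ≠ 0 := by
    rintro h0
    exact h2 (h0 ▸ dvd_zero _)
  refine ⟨hx0, le_antisymm ?_ ((padicValNat_dvd_iff_le hx0).mp h1)⟩
  by_contra hlt
  exact h2 ((padicValNat_dvd_iff_le hx0).mpr (by omega))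

/-- A unit of `ℤ/p^k` (`k ≠ 0`) has a representative prime to `p`. [folklore] -/
theorem not_dvd_val_of_isUnit (hk : k ≠ 0) {x : ZMod (p ^ k)} (hx : IsUnit x) : ¬ p ∣ x.val := by
  haveI : NeZero (p ^ k) := ⟨pow_ne_zero _ hp.out.ne_zero⟩
  rw [← ZMod.natCast_zmod_val x, ZMod.isUnit_iff_coprime] at hx
  exact (Nat.Prime.coprime_iff_not_dvd hp.out).mp
    (Nat.coprime_comm.mp (hx.coprime_dvd_right (dvd_pow_self p hk)))

/-- VALUATION RIGIDITY mod `p^k`: two non-zero natural numbers congruent mod `p^k`, one of `p`-adic valuation `< k`, have the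
same `p`-adic valuation. [folklore] -/
theorem padicValNat_eq_of_modEq_pow {L R : ℕ} (h : L ≡ R [MOD p ^ k]) (hL : L ≠ 0) (hR : R ≠ 0)
    (hLk : padicValNat p L < k) : padicValNat p L = padicValNat p R := by
  by_contra hne
  rcases lt_or_gt_of_ne hne with hlt | hgt
  · -- `p^{v(L)+1} ∣ R` and `p^{v(L)+1} ∣ p^k`, hence `p^{v(L)+1} ∣ L`
    have hdR : p ^ (padicValNat p L + 1) ∣ R := (padicValNat_dvd_iff_le hR).mpr hlt
    have hdk : p ^ (padicValNat p L + 1) ∣ p ^ k := pow_dvd_pow p hLk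
    have hdL : p ^ (padicValNat p L + 1) ∣ L := (h.dvd_iff hdk).mpr hdR
    have := (padicValNat_dvd_iff_le hL).mp hdL
    omega
  · have hdL : p ^ (padicValNat p R + 1) ∣ L := (padicValNat_dvd_iff_le hL).mpr hgt
    have hdk : p ^ (padicValNat p R + 1) ∣ p ^ k := pow_dvd_pow p (by omega)
    have hdR : p ^ (padicValNat p R + 1) ∣ R := (h.dvd_iff hdk).mp hdL
    have := (padicValNat_dvd_iff_le hR).mp hdR
    omega

end ZModPow

/-! ## §1 The squeeze on an abstract additive group (`E(K)` with a `ℤ/p^k`-valued tame height) -/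

section Squeeze

variable {p : ℕ} [hp : Fact p.Prime] {k s t : ℕ} {A : Type*} [AddCommGroup A]

/-- **THE TAME GROSS–ZAGIER SQUEEZE (first lemma of crux card `tame-gross-zagier-kk-prime`, abstract form).**  Let
`h : A → ℤ/p^k` be the diagonal of a `ℤ/p^k`-valued height on an additive group `A` — quadratic in scalars
(`h (n • P) = n² · h P`) and invariant under translation by torsion (`h (T + P) = h P` for `T` of finite order) —, and let
`y = I • P₀ + T` with `T` torsion, `I ≠ 0`, `h P₀` a unit.  If `h y = u · δ₁ · δ₂` for a unit `u` and elements `δ₁, δ₂ ∈ ℤ/p^k`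
divisible EXACTLY by `p^s`, `p^t` (`p^s ∣ δ₁`, `p^{s+1} ∤ δ₁`; `p^t ∣ δ₂`, `p^{t+1} ∤ δ₂`), with `s + t < k` and `2·ord_p I < k`, then
`2·ord_p I = s + t`.  (In the card: `A = E(K)`, `y = y_K` the Heegner point, `P₀` a generator of `E(ℚ)` mod torsion, `h` the tame
height at an inert Kato–Kolyvagin prime `ℓ` of level `p^k`, `δ₁ = δ_ℓ(f)`, `δ₂ = δ_1(f^{d_K})`, `s = ord_p #Ш(E)[p^∞]`,
`t = ord_p #Ш(E^{d_K})[p^∞]`, the identity being the conjectural `TGZ_ℓ`.)  Pure `ℤ/p^k` bookkeeping: both sides are a unit times an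
exact power of `p` below `p^k`. [folklore] -/
theorem two_mul_padicValInt_eq_of_tameSqueeze (h : A → ZMod (p ^ k))
    (h_zsmul : ∀ (n : ℤ) (P : A), h (n • P) = ((n : ZMod (p ^ k)) ^ 2) * h P)
    (h_tors : ∀ (T P : A), IsOfFinAddOrder T → h (T + P) = h P)
    {y P₀ T : A} {I : ℤ} (hy : y = I • P₀ + T) (hT : IsOfFinAddOrder T) (hI : I ≠ 0)
    (hP₀ : IsUnit (h P₀))
    {u : (ZMod (p ^ k))ˣ} {δ₁ δ₂ : ZMod (p ^ k)} (hTGZ : h y = (u : ZMod (p ^ k)) * δ₁ * δ₂)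
    (hδ₁ : (p ^ s : ZMod (p ^ k)) ∣ δ₁ ∧ ¬ (p ^ (s + 1) : ZMod (p ^ k)) ∣ δ₁)
    (hδ₂ : (p ^ t : ZMod (p ^ k)) ∣ δ₂ ∧ ¬ (p ^ (t + 1) : ZMod (p ^ k)) ∣ δ₂)
    (hst : s + t < k) (hIk : 2 * padicValInt p I < k) :
    2 * padicValInt p I = s + t := by
  haveI : NeZero (p ^ k) := ⟨pow_ne_zero _ hp.out.ne_zero⟩
  have hk : k ≠ 0 := by omega
  -- the height of `y`: `h y = I² · h P₀`
  have hy' : h y = ((I : ZMod (p ^ k)) ^ 2) * h P₀ := by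
    rw [hy, add_comm, h_tors T (I • P₀) hT, h_zsmul]
  -- representatives in `ℕ`
  set a : ℕ := (h P₀).val with ha_def
  set b : ℕ := (u : ZMod (p ^ k)).val with hb_def
  set e₁ : ℕ := δ₁.val with he₁_def
  set e₂ : ℕ := δ₂.val with he₂_def
  have ha : ¬ p ∣ a := not_dvd_val_of_isUnit hk hP₀
  have hb : ¬ p ∣ b := not_dvd_val_of_isUnit hk u.isUnit
  have ha0 : a ≠ 0 := fun h0 ↦ ha (h0 ▸ dvd_zero p)
  have hb0 : b ≠ 0 := fun h0 ↦ hb (h0 ▸ dvd_zero p)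
  obtain ⟨he₁0, hve₁⟩ := padicValNat_val_eq_of_exact (by omega) hδ₁
  obtain ⟨he₂0, hve₂⟩ := padicValNat_val_eq_of_exact (by omega) hδ₂
  have hI0 : I.natAbs ≠ 0 := Int.natAbs_ne_zero.mpr hI
  -- both sides as natural numbers cast to `ℤ/p^k`
  have hIcast : ((I : ZMod (p ^ k)) ^ 2) = ((I.natAbs ^ 2 : ℕ) : ZMod (p ^ k)) := by
    have hZ : ((I.natAbs ^ 2 : ℕ) : ℤ) = I ^ 2 := by rw [Nat.cast_pow, Int.natAbs_sq]
    rw [← Int.cast_natCast, hZ, Int.cast_pow]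
  have hL : h y = ((I.natAbs ^ 2 * a : ℕ) : ZMod (p ^ k)) := by
    rw [hy', hIcast, ha_def, Nat.cast_mul, ZMod.natCast_zmod_val]
  have hR : h y = ((b * e₁ * e₂ : ℕ) : ZMod (p ^ k)) := by
    rw [hTGZ, hb_def, he₁_def, he₂_def]
    push_cast
    rw [ZMod.natCast_zmod_val, ZMod.natCast_zmod_val, ZMod.natCast_zmod_val]
  have hmod : I.natAbs ^ 2 * a ≡ b * e₁ * e₂ [MOD p ^ k] :=
    (ZMod.natCast_eq_natCast_iff _ _ _).mp (hL.symm.trans hR)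
  -- valuations of the two sides
  have hvL : padicValNat p (I.natAbs ^ 2 * a) = 2 * padicValInt p I := by
    rw [padicValNat.mul (pow_ne_zero _ hI0) ha0, padicValNat.pow, padicValNat.eq_zero_of_not_dvd ha, add_zero]
    rfl
  have hvR : padicValNat p (b * e₁ * e₂) = s + t := by
    rw [padicValNat.mul (mul_ne_zero hb0 he₁0) he₂0, padicValNat.mul hb0 he₁0,
      padicValNat.eq_zero_of_not_dvd hb, hve₁, hve₂, zero_add]
  have hLne : I.natAbs ^ 2 * a ≠ 0 := mul_ne_zero (pow_ne_zero _ hI0) ha0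
  have hRne : b * e₁ * e₂ ≠ 0 := mul_ne_zero (mul_ne_zero hb0 he₁0) he₂0
  have := padicValNat_eq_of_modEq_pow hmod hLne hRne (by omega)
  omega

end Squeeze

/-! ## §2 On `E(K)`: the squeeze gives STEP L `X11b.IndexLowerBoundAt` (S5's conclusion, by name) -/

section Frame

-- `K : Type`: the tree's ring-class class field theory is universe `0` (as in the crux).
variable (W : WeierstrassCurve ℚ) (p : ℕ) [hp : Fact p.Prime] (K : Type) [Field K] [NumberField K]

/-- **FIRST LEMMA of the card (tree form of `TameGrossZagierSketch.FirstLemma`).**  On `E(K)` (model `W`, any number field `K`):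
a `ℤ/p^k`-valued height diagonal `h` (quadratic in scalars, torsion-invariant — the sketch's `TameHeight` interface, unfolded), a
point `y = I • P₀ + T` (`T` torsion, `I ≠ 0`) with `ord_p [E(K) : ℤy] = ord_p I` and `h P₀` a unit, the identity `h y = u·δ₁·δ₂`
(the consequence of the sketch's `TameGrossZagierAt`, `δ₁ = δ_ℓ(f)`, `δ₂ = δ_1(f^{d_K})`, here arbitrary), exact orders `p^s ∥ δ₁`,
`p^t ∥ δ₂` (the sketch's `ExactPPow`, unfolded) with `s + t < k`, `2·ord_p I < k`, and the bound `s + t ≤ ord_p #Ш(E/K)` (in the card: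
`s = ord_p #Ш(E)[p^∞]`, `t = ord_p #Ш(E^{d_K})[p^∞]` and the odd-`p` decomposition of `Ш(E/K)[p^∞]`) GIVE
`X11b.IndexLowerBoundAt W p K y`: `2·ord_p [E(K) : ℤy] ≤ ord_p #Ш(E/K) + 2·ord_p ∏ c_ℓ(E)` (indeed `2·ord_p [E(K):ℤy] = s + t`).
[folklore] -/
theorem indexLowerBoundAt_of_tameSqueeze {k s t : ℕ}
    (h : (W.baseChange K).toAffine.Point → ZMod (p ^ k))
    (h_zsmul : ∀ (n : ℤ) (P : (W.baseChange K).toAffine.Point), h (n • P) = ((n : ZMod (p ^ k)) ^ 2) * h P)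
    (h_tors : ∀ (T P : (W.baseChange K).toAffine.Point), IsOfFinAddOrder T → h (T + P) = h P)
    {y P₀ T : (W.baseChange K).toAffine.Point} {I : ℤ} (hy : y = I • P₀ + T) (hT : IsOfFinAddOrder T) (hI : I ≠ 0)
    (hidx : padicValNat p (AddSubgroup.zmultiples y).index = padicValInt p I)
    (hP₀ : IsUnit (h P₀))
    {u : (ZMod (p ^ k))ˣ} {δ₁ δ₂ : ZMod (p ^ k)} (hTGZ : h y = (u : ZMod (p ^ k)) * δ₁ * δ₂)
    (hδ₁ : (p ^ s : ZMod (p ^ k)) ∣ δ₁ ∧ ¬ (p ^ (s + 1) : ZMod (p ^ k)) ∣ δ₁)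
    (hδ₂ : (p ^ t : ZMod (p ^ k)) ∣ δ₂ ∧ ¬ (p ^ (t + 1) : ZMod (p ^ k)) ∣ δ₂)
    (hst : s + t < k) (hIk : 2 * padicValInt p I < k)
    (hsha : s + t ≤ padicValNat p (W.baseChange K).shaOrder) :
    X11b.IndexLowerBoundAt W p K y := by
  have hsq := two_mul_padicValInt_eq_of_tameSqueeze h h_zsmul h_tors hy hT hI hP₀ hTGZ hδ₁ hδ₂ hst hIk
  unfold X11b.IndexLowerBoundAt
  rw [hidx]
  omega

/-- The squeeze in fact gives the exact value `2·ord_p [E(K) : ℤy] = s + t` (so, with the card's `s`, `t` and the decomposition of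
`Ш(E/K)[p^∞]`, the Heegner-index IDENTITY up to Tamagawa numbers); recorded for consumers of `X11b.IndexIdentityAt`. [folklore] -/
theorem two_mul_padicValNat_index_eq_of_tameSqueeze {k s t : ℕ}
    (h : (W.baseChange K).toAffine.Point → ZMod (p ^ k))
    (h_zsmul : ∀ (n : ℤ) (P : (W.baseChange K).toAffine.Point), h (n • P) = ((n : ZMod (p ^ k)) ^ 2) * h P)
    (h_tors : ∀ (T P : (W.baseChange K).toAffine.Point), IsOfFinAddOrder T → h (T + P) = h P)
    {y P₀ T : (W.baseChange K).toAffine.Point} {I : ℤ} (hy : y = I • P₀ + T) (hT : IsOfFinAddOrder T) (hI : I ≠ 0)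
    (hidx : padicValNat p (AddSubgroup.zmultiples y).index = padicValInt p I)
    (hP₀ : IsUnit (h P₀))
    {u : (ZMod (p ^ k))ˣ} {δ₁ δ₂ : ZMod (p ^ k)} (hTGZ : h y = (u : ZMod (p ^ k)) * δ₁ * δ₂)
    (hδ₁ : (p ^ s : ZMod (p ^ k)) ∣ δ₁ ∧ ¬ (p ^ (s + 1) : ZMod (p ^ k)) ∣ δ₁)
    (hδ₂ : (p ^ t : ZMod (p ^ k)) ∣ δ₂ ∧ ¬ (p ^ (t + 1) : ZMod (p ^ k)) ∣ δ₂)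
    (hst : s + t < k) (hIk : 2 * padicValInt p I < k) :
    2 * padicValNat p (AddSubgroup.zmultiples y).index = s + t := by
  rw [hidx]
  exact two_mul_padicValInt_eq_of_tameSqueeze h h_zsmul h_tors hy hT hI hP₀ hTGZ hδ₁ hδ₂ hst hIk

end Frame

/-! ## §3 Crux currency: a tame squeeze at every Heegner point of a ♯ frame gives a non-zero mod-`p` Kolyvagin class -/

section Crux

variable (W : WeierstrassCurve ℚ) [W.IsElliptic] [W.IsGloballyMinimal] [NeZero (W.conductorNorm ℤ)]
  (p : ℕ) [hp : Fact p.Prime] (K : Type) [Field K] [NumberField K]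
  (Dt : ModularParametrizationData W (W.conductorNorm ℤ)) (β : ℤ) (ι : K →+* ℂ)

/-- **THE CARD'S ENGINE LANDS ON THE CRUX BY NAME.**  One ♯ frame `(W, p, K, Dt, β, ι)` (the binders of KPA′ ∕ of the registered
stub `stub_kolyvaginPrimitiveAboveBottom` that are used: `p ≥ 5`, `ρ̄_{E,p}` onto, non-CM, `r_an = 1`, `p ∤ ∏ c_ℓ`, `K` imaginary
quadratic with `d_K < −4`, Heegner hypothesis, `L(E^{(d_K)},1) ≠ 0`, `4N ∣ β² − d_K`), the PUBLISHED inputs Gross–Zagier `hGZ`,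
Kolyvagin `hKo`, Kolyvagin's bound `hKoB`, modularity `hmod`, McCallum Cor. 5.6 (divisibility half) `hMc` as binders, and the
HYPOTHESIS `hSq`: at every Heegner point `P` of the frame (`P ↦ heegnerPointComplex Dt H`, `H.β = β`, `P` of infinite order) a TAME
SQUEEZE is available — some level `p^k`, a `ℤ/p^k`-valued quadratic torsion-invariant height `h` on `E(K)`, a decomposition
`P = I • P₀ + T` (`T` torsion, `I ≠ 0`, `ord_p [E(K):ℤP] = ord_p I`, `h P₀` a unit), the identity `h P = u·δ₁·δ₂` (`TGZ_ℓ`) with exact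
orders `p^s ∥ δ₁`, `p^t ∥ δ₂`, `s + t < k`, `2·ord_p I < k`, and `s + t ≤ ord_p #Ш(E/K)`.  CONCLUSION: some Kolyvagin–Heegner datum
`d` at some Kolyvagin level `n` has `d.kolyvaginClass _ 1 ≠ 0` in `H¹(K, E[p])` — the conclusion of KPA′ (item 21400) and of
`stub_kolyvaginPrimitiveAboveBottom` (line `epsilon_matched_retyping` of item 21396).  Proof: §2 at every Heegner point is STEP L
`X11b.IndexLowerBoundAt`, and `AdditiveKoly.exists_kolyvaginClass_ne_zero_of_indexLowerBoundAt` (McCallum §5 backwards).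
CONDITIONAL on every binder; nothing is booked. [cite: McCallumLMS1991, §5 Lemma 5.1 and Cor. 5.6 (p. 310), §4 Cor. 4.5]
[cite: JetchevSkinnerWan2017, §7.4.1 (eq:shalowerK-1)] -/
theorem exists_kolyvaginClass_ne_zero_of_tameSqueeze
    -- published inputs (named facts of the tree)
    (hGZ : gross_zagier (W.conductorNorm ℤ) W K) (hKo : kolyvagin (W.conductorNorm ℤ) W K)
    (hKoB : Kolyvagin1990_padicValNat_card_sha_le (W.conductorNorm ℤ) W K)
    (hmod : hasEntireLFunction_rat) (hMc : McCallum1991_padicValNat_card_sha_primary_add_le_of_globalDivisibility)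
    -- the frame (only the binders that are used)
    (hp5 : 5 ≤ p) (hs : W.HasSurjectiveModNGaloisRep p) (hCM : ¬ W.HasCM) (hr : W.analyticRank = 1)
    (htam : ¬ p ∣ W.tamagawaProduct)
    (hK : IsImaginaryQuadratic K) (hlt : NumberField.discr K < -4)
    (hH : SatisfiesHeegnerHypothesis (W.conductorNorm ℤ) K)
    (hL : (W.quadraticTwist (NumberField.discr K : ℚ)).entireLFunction 1 ≠ 0)
    (hβ : (4 * (W.conductorNorm ℤ : ℤ)) ∣ β ^ 2 - NumberField.discr K)
    -- the hypothesis: a tame squeeze at every Heegner point of the frame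
    (hSq : ∀ (H : HeegnerDatum (W.conductorNorm ℤ) (NumberField.discr K)) (P : (W.baseChange K).toAffine.Point),
      H.β = β → WeierstrassCurve.Affine.Point.map ι.toRatAlgHom P = heegnerPointComplex Dt H → ¬ IsOfFinAddOrder P →
      ∃ (k s t : ℕ) (h : (W.baseChange K).toAffine.Point → ZMod (p ^ k))
        (P₀ T : (W.baseChange K).toAffine.Point) (I : ℤ) (u : (ZMod (p ^ k))ˣ) (δ₁ δ₂ : ZMod (p ^ k)),
        (∀ (n : ℤ) (Q : (W.baseChange K).toAffine.Point), h (n • Q) = ((n : ZMod (p ^ k)) ^ 2) * h Q) ∧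
        (∀ (T' Q : (W.baseChange K).toAffine.Point), IsOfFinAddOrder T' → h (T' + Q) = h Q) ∧
        P = I • P₀ + T ∧ IsOfFinAddOrder T ∧ I ≠ 0 ∧
        padicValNat p (AddSubgroup.zmultiples P).index = padicValInt p I ∧ IsUnit (h P₀) ∧
        h P = (u : ZMod (p ^ k)) * δ₁ * δ₂ ∧
        ((p ^ s : ZMod (p ^ k)) ∣ δ₁ ∧ ¬ (p ^ (s + 1) : ZMod (p ^ k)) ∣ δ₁) ∧
        ((p ^ t : ZMod (p ^ k)) ∣ δ₂ ∧ ¬ (p ^ (t + 1) : ZMod (p ^ k)) ∣ δ₂) ∧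
        s + t < k ∧ 2 * padicValInt p I < k ∧ s + t ≤ padicValNat p (W.baseChange K).shaOrder) :
    ∃ (n : ℕ) (d : KolyvaginHeegnerData Dt β ι n),
      KolyvaginDescent.KolSupp (Zhang2014.IsKolyvaginPrime (W.conductorNorm ℤ) W K p) n ∧
        d.kolyvaginClass hp.out 1 ≠ 0 := by
  refine exists_kolyvaginClass_ne_zero_of_indexLowerBoundAt W p K Dt β ι hGZ hKo hKoB hmod hMc hp5 hs hCM hr htam hK
    hlt hH hL hβ ?_
  intro H P hHβ hP hPinf
  obtain ⟨k, s, t, h, P₀, T, I, u, δ₁, δ₂, h_zsmul, h_tors, hy, hT, hI, hidx, hP₀, hTGZ, hδ₁, hδ₂, hst, hIk, hsha⟩ :=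
    hSq H P hHβ hP hPinf
  exact indexLowerBoundAt_of_tameSqueeze W p K h h_zsmul h_tors hy hT hI hidx hP₀ hTGZ hδ₁ hδ₂ hst hIk hsha

end Crux

end Summit.BirchSwinnertonDyer.BirchSwinnertonDyer.Theorems.AdditiveKoly.TameGrossZagier

end
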